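import Summits.HubbardSuperconductivity.HubbardSuperconductivity.Theorems.CooperPairDMottWalkCooperPairDMottTwoHoleGapSchur

/-!
# Route `CooperPairDMottWalk`, crux `CooperPairDMott` (stmt-HubbardSuperconductivity-1177):
# the block architecture of the two-hole gap (stub `stub_twoHoleGapOrthogonal`)

Companion of `…TwoHoleGapSchur` (the Schur-complement estimates). The gap on `Ω^⊥ ∩ K` demanded by
`stub_twoHoleGapOrthogonal` closes like `b²/L²` (curvature of the pair band at its bottom on the
torus of `(L/2)²` plaquettes), so no estimate that is not resolved by the plaquette momentum can be
uniform in `L`. This file proves the momentum-resolved ARCHITECTURE as linear algebra over `ℂⁿ`: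

* `le_rayleigh_of_schur_trial` — the Temple-type Schur bound from ONE trial vector `Φ ≠ 0` of a
  subspace, in homogeneous form: a gap `g` above `E` on `Φ^⊥ ∩ K` and the scalar inequality
  `(‖HΦ‖² ‖Φ‖² − ⟨Φ,HΦ⟩²) ≤ (⟨Φ,HΦ⟩ − E ‖Φ‖²) · g · ‖Φ‖²` ("leakage ≤ excess × gap") give `H ≥ E` on
  `K`;
* `gap_orthogonal_of_blocks_schur`, `exists_gap_orthogonal_of_blocks_schur` — for an `H`-decoupled
  orthogonal resolution `Pb j` of `K` into blocks (the isotypic components of a symmetry group of `H`,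
  here the plaquette translations) with one trial vector `Φ j ∈ Pb j K` per block (the plane waves of
  the dressed pair band) and a level `E₁` strictly above the Rayleigh quotient of `Φ j₀`, the
  conclusion of the stub at one size, `∃ Ω E₁, minEnergyOn H K < E₁ ∧ (H ≥ E₁ on Ω^⊥ ∩ K)`, follows
  from exactly two inputs: (E1) in every block the part orthogonal to its trial vector is gapped above
  `E₁` (the two-holon threshold), and (E2) the scalar Schur inequality of every trial vector `Φ j`,
  `j ≠ j₀` (the pair-band dispersion above its bottom, with the leakage `‖Q H Φ_j‖²/g_j` absorbed).

References: G. Temple, Proc. R. Soc. A 119 (1928) 276; T. Kato, *Perturbation Theory for Linear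
Operators* (1966) §II.2; H. Yao, W.-F. Tsai, S. A. Kivelson, PRB 76 (2007) 161104 (the pair band of
the checkerboard Hubbard model). All statements are [folklore]; no definition is introduced.
-/

set_option linter.dupNamespace false -- the route namespace `HubbardSuperconductivity.HubbardSuperconductivity` is mandated

namespace Summit.HubbardSuperconductivity.HubbardSuperconductivity.Theorems.CooperPairDMottWalk

open Matrix
open scoped ComplexOrder
open Literature.MathematicalPhysics.QuantumLattice
open Literature.MathematicalPhysics.QuantumLattice.EigenvalueContinuation (re_star_dotProduct_self_nonneg)

section Generic

variable {ι : Type*} [Fintype ι]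

/-! ### One trial vector: the homogeneous Schur inequality -/

/-- The quadratic form of a Hermitian matrix is real: `Im⟨Φ, HΦ⟩ = 0`. [folklore] -/
theorem im_form_self_eq_zero {H : Matrix ι ι ℂ} (hH : H.IsHermitian) (Φ : ι → ℂ) :
    (star Φ ⬝ᵥ H *ᵥ Φ).im = 0 := by
  have h : star (star Φ ⬝ᵥ H *ᵥ Φ) = star Φ ⬝ᵥ H *ᵥ Φ := by
    rw [← star_dotProduct, star_mulVec_dotProduct_of_isHermitian hH]
  rw [Complex.star_def] at h
  exact Complex.conj_eq_iff_im.1 h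

/-- `|⟨Φ, HΦ⟩|² = (Re⟨Φ, HΦ⟩)²` for Hermitian `H`. [folklore] -/
theorem norm_sq_form_self {H : Matrix ι ι ℂ} (hH : H.IsHermitian) (Φ : ι → ℂ) :
    ‖star Φ ⬝ᵥ H *ᵥ Φ‖ ^ 2 = (star Φ ⬝ᵥ H *ᵥ Φ).re ^ 2 := by
  rw [Complex.sq_norm, Complex.normSq_apply, im_form_self_eq_zero hH]
  ring

/-- **The leakage of a unit vector**: `‖w − ⟨Φ, w⟩ Φ‖² = ‖w‖² − |⟨Φ, w⟩|²` for unit `Φ`. [folklore] -/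
theorem re_star_dotProduct_sub_proj_self {Φ : ι → ℂ} (hΦ1 : star Φ ⬝ᵥ Φ = 1) (w : ι → ℂ) :
    (star (w - (star Φ ⬝ᵥ w) • Φ) ⬝ᵥ (w - (star Φ ⬝ᵥ w) • Φ)).re =
      (star w ⬝ᵥ w).re - ‖star Φ ⬝ᵥ w‖ ^ 2 := by
  classical
  have hn : ∀ (c : ℂ) (v : ι → ℂ), (star (c • v) ⬝ᵥ (c • v)).re = ‖c‖ ^ 2 * (star v ⬝ᵥ v).re :=
    fun c v => by simpa only [one_mulVec] using re_form_smul (1 : Matrix ι ι ℂ) c v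
  rw [sub_eq_add_neg, ← neg_smul, re_star_dotProduct_add_self, hn, hΦ1,
    Complex.one_re, mul_one, norm_neg, dotProduct_smul, smul_eq_mul, star_dotProduct w Φ,
    Complex.star_def, neg_mul, Complex.neg_re, Complex.mul_conj, Complex.ofReal_re,
    Complex.normSq_eq_norm_sq]
  ring

/-- **Schur bound from ONE trial vector, homogeneous form.** Let `H` be Hermitian, `K` a subspace,
`0 ≠ Φ ∈ K`, `E` a level and `g > 0`. If `(E + g) ‖ψ‖² ≤ Re⟨ψ, Hψ⟩` for all `ψ ∈ K` orthogonal to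
`Φ`, and the three scalars `a = ‖Φ‖²`, `h = Re⟨Φ, HΦ⟩`, `s = ‖HΦ‖²` satisfy
`s a − h² ≤ (h − E a) g a` (leakage times norm ≤ excess times gap), then `E ‖ψ‖² ≤ Re⟨ψ, Hψ⟩` on
all of `K` (`le_rayleigh_of_schur_rank_one` for `Φ/‖Φ‖`; Temple 1928). [folklore] -/
theorem le_rayleigh_of_schur_trial (H : Matrix ι ι ℂ) (hH : H.IsHermitian)
    (K : Submodule ℂ (ι → ℂ)) {Φ : ι → ℂ} (hΦK : Φ ∈ K) (hΦ0 : Φ ≠ 0) {E g : ℝ} (hg : 0 < g)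
    (hperp : ∀ ψ ∈ K, star Φ ⬝ᵥ ψ = 0 → (E + g) * (star ψ ⬝ᵥ ψ).re ≤ (star ψ ⬝ᵥ H *ᵥ ψ).re)
    (hΦ : (star (H *ᵥ Φ) ⬝ᵥ (H *ᵥ Φ)).re * (star Φ ⬝ᵥ Φ).re - (star Φ ⬝ᵥ H *ᵥ Φ).re ^ 2 ≤
      ((star Φ ⬝ᵥ H *ᵥ Φ).re - E * (star Φ ⬝ᵥ Φ).re) * g * (star Φ ⬝ᵥ Φ).re) :
    ∀ ψ ∈ K, E * (star ψ ⬝ᵥ ψ).re ≤ (star ψ ⬝ᵥ H *ᵥ ψ).re := by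
  classical
  obtain ⟨c, hc0, hc1⟩ := exists_smul_unit hΦ0
  -- notation for the scalars
  set a := (star Φ ⬝ᵥ Φ).re with ha
  set h := (star Φ ⬝ᵥ H *ᵥ Φ).re with hh
  set s := (star (H *ᵥ Φ) ⬝ᵥ (H *ᵥ Φ)).re with hs
  set t := ‖c‖ ^ 2 with ht
  have hn : ∀ v : ι → ℂ, (star (c • v) ⬝ᵥ (c • v)).re = ‖c‖ ^ 2 * (star v ⬝ᵥ v).re := fun v => by
    simpa only [one_mulVec] using re_form_smul (1 : Matrix ι ι ℂ) c v
  have hta : t * a = 1 := by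
    have := congrArg Complex.re hc1
    rwa [hn, Complex.one_re] at this
  refine le_rayleigh_of_schur_rank_one H hH K (K.smul_mem c hΦK) hc1 hg (fun ψ hψ h0 => ?_) ?_
  · refine hperp ψ hψ ?_
    rw [star_smul, smul_dotProduct, smul_eq_mul, mul_eq_zero] at h0
    exact h0.resolve_left (by rwa [Complex.star_def, map_eq_zero])
  · -- the scalar inequality for the unit vector `c • Φ`
    have hform : (star (c • Φ) ⬝ᵥ H *ᵥ (c • Φ)).re = t * h := re_form_smul H c Φ
    have hleak : (star (H *ᵥ (c • Φ) - (star (c • Φ) ⬝ᵥ H *ᵥ (c • Φ)) • (c • Φ)) ⬝ᵥ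
        (H *ᵥ (c • Φ) - (star (c • Φ) ⬝ᵥ H *ᵥ (c • Φ)) • (c • Φ))).re = t * s - (t * h) ^ 2 := by
      rw [re_star_dotProduct_sub_proj_self hc1, norm_sq_form_self hH, hform, mulVec_smul, hn]
    rw [hleak, hform]
    have e1 : t ^ 2 * ((star (H *ᵥ Φ) ⬝ᵥ (H *ᵥ Φ)).re * a - h ^ 2) = t * s - (t * h) ^ 2 := by
      rw [← hs]; linear_combination (t * s) * hta
    have e2 : t ^ 2 * ((h - E * a) * g * a) = (t * h - E) * g := by
      linear_combination (t * h * g - E * g * (t * a + 1)) * hta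
    have key : t * s - (t * h) ^ 2 ≤ (t * h - E) * g := by
      rw [← e1, ← e2]
      exact mul_le_mul_of_nonneg_left hΦ (sq_nonneg t)
    rw [← sub_nonneg]
    have : t * h - (E + (t * s - (t * h) ^ 2) / g) = ((t * h - E) * g - (t * s - (t * h) ^ 2)) / g := by
      field_simp
      ring
    rw [this]
    exact div_nonneg (sub_nonneg.2 key) hg.le

/-! ### The architecture: symmetry blocks, one trial vector per block -/

/-- **Gap on `Ω^⊥` from symmetry blocks and one Schur inequality per block.** Let `Pb j`, `j : J`,
resolve the identity on `K` (`∑ j, Pb j ψ = ψ`), map `K` into `K`, be idempotent on `K`, with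
mutually orthogonal and `H`-decoupled ranges (e.g. the isotypic projections of a finite abelian
symmetry group of the Hermitian `H`), and let `Φ j ∈ Pb j K` be trial vectors (possibly `0`), `j₀` a
distinguished block and `E₁` a level. Suppose
(E1) for every `j`: `(E₁ + g j) ‖ψ‖² ≤ Re⟨ψ, Hψ⟩` for `ψ ∈ Pb j K` with `⟨Φ j, ψ⟩ = 0` (`g j > 0`);
(E2) for every `j ≠ j₀` the scalar Schur inequality of `le_rayleigh_of_schur_trial` for `Φ j`:
  `‖HΦ_j‖² ‖Φ_j‖² − ⟨Φ_j,HΦ_j⟩² ≤ (⟨Φ_j,HΦ_j⟩ − E₁ ‖Φ_j‖²) g_j ‖Φ_j‖²`.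
Then `E₁ ‖ψ‖² ≤ Re⟨ψ, Hψ⟩` for every `ψ ∈ K` orthogonal to `Ω := Φ j₀`
(`gap_orthogonal_of_blocks` with the per-block Schur bound). [folklore] -/
theorem gap_orthogonal_of_blocks_schur {J : Type*} [Fintype J] [DecidableEq J]
    (H : Matrix ι ι ℂ) (hH : H.IsHermitian) (K : Submodule ℂ (ι → ℂ)) (Pb : J → Matrix ι ι ℂ)
    (j₀ : J) (Φ : J → ι → ℂ) (E₁ : ℝ) (g : J → ℝ) (hg : ∀ j, 0 < g j)
    (hsum : ∀ ψ ∈ K, ∑ j, Pb j *ᵥ ψ = ψ)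
    (hPK : ∀ j, ∀ ψ ∈ K, Pb j *ᵥ ψ ∈ K)
    (hPP : ∀ j, ∀ ψ ∈ K, Pb j *ᵥ (Pb j *ᵥ ψ) = Pb j *ᵥ ψ)
    (horth : ∀ i j, i ≠ j → ∀ ψ ∈ K, ∀ ψ' ∈ K, star (Pb i *ᵥ ψ) ⬝ᵥ (Pb j *ᵥ ψ') = 0)
    (hblock : ∀ i j, i ≠ j → ∀ ψ ∈ K, star (Pb i *ᵥ ψ) ⬝ᵥ (H *ᵥ (Pb j *ᵥ ψ)) = 0)
    (hΦ : ∀ j, ∃ φ ∈ K, Φ j = Pb j *ᵥ φ)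
    (hE1 : ∀ j, ∀ ψ ∈ K, star (Φ j) ⬝ᵥ (Pb j *ᵥ ψ) = 0 →
      (E₁ + g j) * (star (Pb j *ᵥ ψ) ⬝ᵥ (Pb j *ᵥ ψ)).re ≤
        (star (Pb j *ᵥ ψ) ⬝ᵥ H *ᵥ (Pb j *ᵥ ψ)).re)
    (hE2 : ∀ j, j ≠ j₀ →
      (star (H *ᵥ Φ j) ⬝ᵥ (H *ᵥ Φ j)).re * (star (Φ j) ⬝ᵥ Φ j).re - (star (Φ j) ⬝ᵥ H *ᵥ Φ j).re ^ 2 ≤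
        ((star (Φ j) ⬝ᵥ H *ᵥ Φ j).re - E₁ * (star (Φ j) ⬝ᵥ Φ j).re) * g j * (star (Φ j) ⬝ᵥ Φ j).re) :
    ∀ ψ ∈ K, star (Φ j₀) ⬝ᵥ ψ = 0 → E₁ * (star ψ ⬝ᵥ ψ).re ≤ (star ψ ⬝ᵥ H *ᵥ ψ).re := by
  classical
  -- the trial vector of block `j` is orthogonal to the other blocks
  have hΦorth : ∀ j i, i ≠ j → ∀ ψ ∈ K, star (Φ j) ⬝ᵥ (Pb i *ᵥ ψ) = 0 := by
    intro j i hij ψ hψ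
    obtain ⟨φ, hφK, hφ⟩ := hΦ j
    rw [hφ]
    exact horth j i (Ne.symm hij) φ hφK ψ hψ
  -- a block with no gap condition needed beyond (E1): `ψ ⊥ Φ j` inside block `j`
  have hE1' : ∀ j, ∀ ψ ∈ K, star (Φ j) ⬝ᵥ (Pb j *ᵥ ψ) = 0 →
      E₁ * (star (Pb j *ᵥ ψ) ⬝ᵥ (Pb j *ᵥ ψ)).re ≤ (star (Pb j *ᵥ ψ) ⬝ᵥ H *ᵥ (Pb j *ᵥ ψ)).re := by
    intro j ψ hψ h0
    have := hE1 j ψ hψ h0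
    have hpos := re_star_dotProduct_self_nonneg (Pb j *ᵥ ψ)
    nlinarith [hg j]
  refine gap_orthogonal_of_blocks H K Pb j₀ (Φ j₀) E₁ hsum (fun i j hij ψ hψ => horth i j hij ψ hψ ψ hψ)
    hblock (fun j hj ψ hψ => hΦorth j₀ j hj ψ hψ) (fun j hj ψ hψ => ?_) (fun ψ hψ hΩ => hE1' j₀ ψ hψ hΩ)
  -- block `j ≠ j₀`: the one-trial-vector Schur bound on the block `K_j = Pb j K`
  by_cases hΦ0 : Φ j = 0
  · exact hE1' j ψ hψ (by rw [hΦ0, star_zero, zero_dotProduct])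
  · let Kj : Submodule ℂ (ι → ℂ) := K.map (Matrix.toLin' (Pb j))
    have hmem : ∀ {v}, v ∈ Kj ↔ ∃ φ ∈ K, Pb j *ᵥ φ = v := fun {v} => by
      simp only [Kj, Submodule.mem_map, Matrix.toLin'_apply]
    have hΦKj : Φ j ∈ Kj := by
      obtain ⟨φ, hφK, hφ⟩ := hΦ j
      exact hmem.2 ⟨φ, hφK, hφ.symm⟩
    have hfix : ∀ v ∈ Kj, Pb j *ᵥ v = v := fun v hv => by
      obtain ⟨φ, hφK, rfl⟩ := hmem.1 hv
      exact hPP j φ hφK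
    have hKjK : ∀ v ∈ Kj, v ∈ K := fun v hv => by
      obtain ⟨φ, hφK, rfl⟩ := hmem.1 hv
      exact hPK j φ hφK
    refine le_rayleigh_of_schur_trial H hH Kj hΦKj hΦ0 (hg j) (fun v hv hΦv => ?_) (hE2 j hj) _
      (hmem.2 ⟨ψ, hψ, rfl⟩)
    have h := hE1 j v (hKjK v hv) (by rw [hfix v hv]; exact hΦv)
    rwa [hfix v hv] at h

/-- **The conclusion of the stub from the block architecture.** Under the hypotheses of
`gap_orthogonal_of_blocks_schur`, if moreover the level `E₁` lies strictly above the Rayleigh quotient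
of the distinguished trial vector, `Re⟨Φ j₀, H Φ j₀⟩ < E₁ ‖Φ j₀‖²` (so `Φ j₀ ≠ 0`: the bottom of the
pair band is below the level), then `∃ Ω E₁, minEnergyOn H K < E₁ ∧ (H ≥ E₁ on Ω^⊥ ∩ K)` with
`Ω = Φ j₀`. For `stub_twoHoleGapOrthogonal` it remains to supply (E1) and (E2) for the breathing
torus, uniformly in `L` (files `…TwoHoleGapMomentum`, `…TwoHoleGap`). [folklore] -/
theorem exists_gap_orthogonal_of_blocks_schur {J : Type*} [Fintype J] [DecidableEq J]
    (H : Matrix ι ι ℂ) (hH : H.IsHermitian) (K : Submodule ℂ (ι → ℂ)) (Pb : J → Matrix ι ι ℂ)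
    (j₀ : J) (Φ : J → ι → ℂ) (E₁ : ℝ) (g : J → ℝ) (hg : ∀ j, 0 < g j)
    (hsum : ∀ ψ ∈ K, ∑ j, Pb j *ᵥ ψ = ψ)
    (hPK : ∀ j, ∀ ψ ∈ K, Pb j *ᵥ ψ ∈ K)
    (hPP : ∀ j, ∀ ψ ∈ K, Pb j *ᵥ (Pb j *ᵥ ψ) = Pb j *ᵥ ψ)
    (horth : ∀ i j, i ≠ j → ∀ ψ ∈ K, ∀ ψ' ∈ K, star (Pb i *ᵥ ψ) ⬝ᵥ (Pb j *ᵥ ψ') = 0)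
    (hblock : ∀ i j, i ≠ j → ∀ ψ ∈ K, star (Pb i *ᵥ ψ) ⬝ᵥ (H *ᵥ (Pb j *ᵥ ψ)) = 0)
    (hΦ : ∀ j, ∃ φ ∈ K, Φ j = Pb j *ᵥ φ)
    (hlt : (star (Φ j₀) ⬝ᵥ H *ᵥ Φ j₀).re < E₁ * (star (Φ j₀) ⬝ᵥ Φ j₀).re)
    (hE1 : ∀ j, ∀ ψ ∈ K, star (Φ j) ⬝ᵥ (Pb j *ᵥ ψ) = 0 →
      (E₁ + g j) * (star (Pb j *ᵥ ψ) ⬝ᵥ (Pb j *ᵥ ψ)).re ≤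
        (star (Pb j *ᵥ ψ) ⬝ᵥ H *ᵥ (Pb j *ᵥ ψ)).re)
    (hE2 : ∀ j, j ≠ j₀ →
      (star (H *ᵥ Φ j) ⬝ᵥ (H *ᵥ Φ j)).re * (star (Φ j) ⬝ᵥ Φ j).re - (star (Φ j) ⬝ᵥ H *ᵥ Φ j).re ^ 2 ≤
        ((star (Φ j) ⬝ᵥ H *ᵥ Φ j).re - E₁ * (star (Φ j) ⬝ᵥ Φ j).re) * g j * (star (Φ j) ⬝ᵥ Φ j).re) :
    ∃ (Ω : ι → ℂ) (E₁ : ℝ), H.minEnergyOn K < E₁ ∧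
      ∀ ψ ∈ K, star Ω ⬝ᵥ ψ = 0 → E₁ * (star ψ ⬝ᵥ ψ).re ≤ (star ψ ⬝ᵥ H *ᵥ ψ).re := by
  classical
  have hΦK : Φ j₀ ∈ K := by
    obtain ⟨φ, hφK, hφ⟩ := hΦ j₀
    rw [hφ]
    exact hPK j₀ φ hφK
  -- normalise `Φ j₀` (it is nonzero since its Rayleigh quotient is strictly below `E₁ ‖Φ j₀‖²`)
  have hΦ0 : Φ j₀ ≠ 0 := by
    intro h0
    rw [h0, star_zero, zero_dotProduct, zero_dotProduct, Complex.zero_re, mul_zero] at hlt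
    exact lt_irrefl _ hlt
  obtain ⟨c, hc0, hc1⟩ := exists_smul_unit hΦ0
  have hta : ‖c‖ ^ 2 * (star (Φ j₀) ⬝ᵥ Φ j₀).re = 1 := by
    have := congrArg Complex.re hc1
    have hn : (star (c • Φ j₀) ⬝ᵥ (c • Φ j₀)).re = ‖c‖ ^ 2 * (star (Φ j₀) ⬝ᵥ Φ j₀).re := by
      simpa only [one_mulVec] using re_form_smul (1 : Matrix ι ι ℂ) c (Φ j₀)
    rwa [hn, Complex.one_re] at this
  have hlt' : (star (c • Φ j₀) ⬝ᵥ H *ᵥ (c • Φ j₀)).re < E₁ := by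
    rw [re_form_smul]
    have hpos : 0 < ‖c‖ ^ 2 := by positivity
    calc ‖c‖ ^ 2 * (star (Φ j₀) ⬝ᵥ H *ᵥ Φ j₀).re < ‖c‖ ^ 2 * (E₁ * (star (Φ j₀) ⬝ᵥ Φ j₀).re) :=
        mul_lt_mul_of_pos_left hlt hpos
      _ = E₁ := by rw [← mul_assoc, mul_comm (‖c‖ ^ 2), mul_assoc, hta, mul_one]
  refine exists_gap_orthogonal_of_rayleigh_lt H hH K (Φ j₀) (K.smul_mem c hΦK) hc1 hlt'
    (gap_orthogonal_of_blocks_schur H hH K Pb j₀ Φ E₁ g hg hsum hPK hPP horth hblock hΦ hE1 hE2)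

/-! ### Registered form -/

/-- **Registered sub-goal `twoHoleGap_blocksSchur`** (closed form, as registered on the crux item): the
block architecture `exists_gap_orthogonal_of_blocks_schur`. [folklore] -/
theorem twoHoleGap_blocksSchur : ∀ {ι : Type} [Fintype ι] {J : Type} [Fintype J] [DecidableEq J] (H : Matrix ι ι ℂ), H.IsHermitian → ∀ (K : Submodule ℂ (ι → ℂ)) (Pb : J → Matrix ι ι ℂ) (j₀ : J) (Φ : J → ι → ℂ) (E₁ : ℝ) (g : J → ℝ), (∀ j, 0 < g j) → (∀ ψ ∈ K, ∑ j, Pb j *ᵥ ψ = ψ) → (∀ j, ∀ ψ ∈ K, Pb j *ᵥ ψ ∈ K) → (∀ j, ∀ ψ ∈ K, Pb j *ᵥ (Pb j *ᵥ ψ) = Pb j *ᵥ ψ) → (∀ i j, i ≠ j → ∀ ψ ∈ K, ∀ ψ' ∈ K, star (Pb i *ᵥ ψ) ⬝ᵥ (Pb j *ᵥ ψ') = 0) → (∀ i j, i ≠ j → ∀ ψ ∈ K, star (Pb i *ᵥ ψ) ⬝ᵥ (H *ᵥ (Pb j *ᵥ ψ)) = 0) → (∀ j, ∃ φ ∈ K,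 Φ j = Pb j *ᵥ φ) → (star (Φ j₀) ⬝ᵥ H *ᵥ Φ j₀).re < E₁ * (star (Φ j₀) ⬝ᵥ Φ j₀).re → (∀ j, ∀ ψ ∈ K, star (Φ j) ⬝ᵥ (Pb j *ᵥ ψ) = 0 → (E₁ + g j) * (star (Pb j *ᵥ ψ) ⬝ᵥ (Pb j *ᵥ ψ)).re ≤ (star (Pb j *ᵥ ψ) ⬝ᵥ H *ᵥ (Pb j *ᵥ ψ)).re) → (∀ j, j ≠ j₀ → (star (H *ᵥ Φ j) ⬝ᵥ (H *ᵥ Φ j)).re * (star (Φ j) ⬝ᵥ Φ j).re - (star (Φ j) ⬝ᵥ H *ᵥ Φ j).re ^ 2 ≤ ((star (Φ j) ⬝ᵥ H *ᵥ Φ j).re - E₁ * (star (Φ j) ⬝ᵥ Φ j).re) * g j * (star (Φ j) ⬝ᵥ Φ j).re) → ∃ (Ω : ι → ℂ) (E₁ : ℝ), H.minEnergyOn K < E₁ ∧ ∀ ψ ∈ K, star Ω ⬝ᵥ ψ = 0 → E₁ * (star ψ ⬝ᵥ ψ).re ≤ (star ψ ⬝ᵥ H *ᵥ ψ).re :=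
  fun H hH K Pb j₀ Φ E₁ g hg hsum hPK hPP horth hblock hΦ hlt hE1 hE2 =>
    exists_gap_orthogonal_of_blocks_schur H hH K Pb j₀ Φ E₁ g hg hsum hPK hPP horth hblock hΦ hlt hE1 hE2

end Generic

end Summit.HubbardSuperconductivity.HubbardSuperconductivity.Theorems.CooperPairDMottWalk
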